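import Summits.QuantumFields.YangMills.Theorems.UnitScaleTiltProp7OffsetFamilyTransported
import HarnessLib

/-!
# Route `UnitScaleTilt`, crux K1 «MinimiserStabilityRegPr» (stmt-QuantumFields-19200), route-R E′ path (α′), S3 K-form engine, row (H) of R5 — FILE 9q (junction algebra (J-δV)):
# THE RECENTRING GROUP OF LEMMA-H AT THE OFFSET-COMB FAMILY AGAINST A COARSE TRANSPORT — exact inequalities (no booking): for two bases `c₀, c₀′` and the same fine site `z`,
# `‖R(P⁻¹)m − R(P′⁻¹)m′‖ ≤ ‖R(S)m − m′‖ + ‖[S⁻¹P′P⁻¹, m]‖` for ANY bi-contractive transport `S` (isometry of the adjoint transport, twice): the first term is the COARSE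
# covariant difference of the centre data (★p1 g16's `δ^V(φ₀)`-type letter, with the transport `S` left to the consumer), the second a closed-loop commutator «(Kg′-J)»;
# plus the `W̄ ↔ S` defect bridge `‖R(S)m − m′‖ ≤ ‖R(T)m − m′‖ + ‖[T⁻¹S, m]‖` «(Kg″)» and, in T³ letters, the path form of the offset-comb model
# `R(axialT 𝒲 c^h z)⁻¹ R(𝒲(c₀;[ι]^h))⁻¹ m = R(𝒲(c₀; [ι]^h ++ Γ_(0,rel c^h z)))⁻¹ m` and the resulting pointwise junction inequality (routeR-w1 LOCATE (J-δV)(a)(b)(c), 2026-08-28 23:16Z).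

Cell `ym3-torus`, D-0154 (3c) twin-width seat `ym-routeR-w1` (gen 6); standing PASS R4′ (★p1 g16 23:01Z).  THEOREMS ONLY (0 `def`, 0 `sorry`); `--supports stmt-QuantumFields-19200`,
count-neutral.  YM₃ on T³ is a ladder rung (R3), not the Clay problem; nothing here claims a stub, the crux, d = 4 or the gap.

WHAT (ns `…Theorems.Prop7LocalModelJunction`).
* §1 (normed ring, bi-contractive units): `norm_mul_unit_inv_eq` (`‖X·u⁻¹‖ = ‖X‖`), `norm_R_sub_self_eq_comm` (`‖R(U)m − m‖ = ‖Um − mU‖`), ★★ `norm_R_inv_sub_R_inv_le` ((J-δV-a):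
  `‖R(P⁻¹)m − R(P′⁻¹)m′‖ ≤ ‖R(S)m − m′‖ + ‖(S⁻¹P′P⁻¹)m − m(S⁻¹P′P⁻¹)‖`), ★ `norm_R_sub_le_of_defect` ((J-δV-c): `‖R(S)m − m′‖ ≤ ‖R(T)m − m′‖ + ‖(T⁻¹S)m − m(T⁻¹S)‖`),
  ★ `norm_R_mul_sub_le` ((J-δV-b), one telescoping step: `‖R(S₂S₁)m₀ − m₂‖ ≤ ‖R(S₁)m₀ − m₁‖ + ‖R(S₂)m₁ − m₂‖`).
* §2 (any torus, bi-contractive `V`): ★ `axialModel_offset_eq_R_path` (the offset-comb model is `R(path holonomy)⁻¹` of the centre datum), ★★ `norm_axialModel_offset_sub_le` (the pointwise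
  junction inequality between two bases at the same `z`, transport `S` free).
HONEST SCOPE.  Exact algebra; the choice of `S` (straight coarse transport), the telescoping along a coarse path and every booking (`δ^V`, (Kg′-J), (Kg″)) are the consumer's.

References: T. Bałaban, CMP 99 (1985) 389–434 [Balaban1985BackgroundPropagators] ((3.1) p.390, (3.12) p.392); CMP 102 (1985) 255–275 [Balaban1985UV3] ((27) p.263).
-/

set_option autoImplicit false

noncomputable section

open scoped BigOperators

namespace Summit.QuantumFields.YangMills.Theorems.Prop7LocalModelJunction

open Literature.MathematicalPhysics.QuantumFieldTheory.Balaban1983to89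
open B7Prop1Explicit (Letter e seg treeWord hol disp_seg)
open B9Eq39Adjoint (R R_def R_sub R_mul_R R_inv_R R_R_inv)
open B10Eq27TorusAxialLog (holT axialT rel pull transl holT_append)
open Summit.QuantumFields.YangMills.Theorems.Prop7AxialLocalModel (bicontr_holT)
open Summit.QuantumFields.YangMills.Theorems.Prop7PinnedSupOfGradient (norm_R_eq)

/-! ## §1 Adjoint-transport algebra -/

section Algebra

variable {𝔸 : Type*} [NormedRing 𝔸]

/-- `‖X·u⁻¹‖ = ‖X‖` for a bi-contractive unit `u`. [cite: Balaban1985BackgroundPropagators, (3.1) p.390] -/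
theorem norm_mul_unit_inv_eq {u : 𝔸ˣ} (hu : ‖(u : 𝔸)‖ ≤ 1 ∧ ‖((u⁻¹ : 𝔸ˣ) : 𝔸)‖ ≤ 1) (X : 𝔸) : ‖X * ((u⁻¹ : 𝔸ˣ) : 𝔸)‖ = ‖X‖ := by
  refine le_antisymm ((norm_mul_le _ _).trans (by nlinarith [norm_nonneg X, hu.2])) ?_
  have e : X = X * ((u⁻¹ : 𝔸ˣ) : 𝔸) * (u : 𝔸) := by rw [mul_assoc, Units.inv_mul, mul_one]
  calc ‖X‖ = ‖X * ((u⁻¹ : 𝔸ˣ) : 𝔸) * (u : 𝔸)‖ := by rw [← e]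
    _ ≤ ‖X * ((u⁻¹ : 𝔸ˣ) : 𝔸)‖ * ‖(u : 𝔸)‖ := norm_mul_le _ _
    _ ≤ ‖X * ((u⁻¹ : 𝔸ˣ) : 𝔸)‖ := by nlinarith [norm_nonneg (X * ((u⁻¹ : 𝔸ˣ) : 𝔸)), hu.1]

/-- `‖R(U)m − m‖ = ‖Um − mU‖` for a bi-contractive unit `U`. [cite: Balaban1985BackgroundPropagators, (3.1) p.390] -/
theorem norm_R_sub_self_eq_comm {U : 𝔸ˣ} (hU : ‖(U : 𝔸)‖ ≤ 1 ∧ ‖((U⁻¹ : 𝔸ˣ) : 𝔸)‖ ≤ 1) (m : 𝔸) :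
    ‖R U m - m‖ = ‖(U : 𝔸) * m - m * (U : 𝔸)‖ := by
  have e : R U m - m = ((U : 𝔸) * m - m * (U : 𝔸)) * ((U⁻¹ : 𝔸ˣ) : 𝔸) := by
    rw [R_def, sub_mul, mul_assoc m, Units.mul_inv, mul_one]
  rw [e, norm_mul_unit_inv_eq hU]

/-- ★★ **(J-δV-a) TWO LOCAL MODELS AT THE SAME SITE AGAINST A COARSE TRANSPORT**: for bi-contractive `P, P′, S`,
`‖R(P⁻¹)m − R(P′⁻¹)m′‖ ≤ ‖R(S)m − m′‖ + ‖(S⁻¹P′P⁻¹)·m − m·(S⁻¹P′P⁻¹)‖` — the coarse covariant difference of the data plus a closed-loop commutator.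
[cite: Balaban1985BackgroundPropagators, (3.1) p.390, (3.12) p.392] -/
theorem norm_R_inv_sub_R_inv_le {P P' S : 𝔸ˣ} (hP : ‖(P : 𝔸)‖ ≤ 1 ∧ ‖((P⁻¹ : 𝔸ˣ) : 𝔸)‖ ≤ 1) (hP' : ‖(P' : 𝔸)‖ ≤ 1 ∧ ‖((P'⁻¹ : 𝔸ˣ) : 𝔸)‖ ≤ 1)
    (hS : ‖(S : 𝔸)‖ ≤ 1 ∧ ‖((S⁻¹ : 𝔸ˣ) : 𝔸)‖ ≤ 1) (m m' : 𝔸) :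
    ‖R P⁻¹ m - R P'⁻¹ m'‖ ≤ ‖R S m - m'‖ + ‖((S⁻¹ * P' * P⁻¹ : 𝔸ˣ) : 𝔸) * m - m * ((S⁻¹ * P' * P⁻¹ : 𝔸ˣ) : 𝔸)‖ := by
  have hP'i : ‖((P'⁻¹ : 𝔸ˣ) : 𝔸)‖ ≤ 1 ∧ ‖(((P'⁻¹)⁻¹ : 𝔸ˣ) : 𝔸)‖ ≤ 1 := ⟨hP'.2, by rw [inv_inv]; exact hP'.1⟩
  have hU : ‖((S⁻¹ * P' * P⁻¹ : 𝔸ˣ) : 𝔸)‖ ≤ 1 ∧ ‖(((S⁻¹ * P' * P⁻¹)⁻¹ : 𝔸ˣ) : 𝔸)‖ ≤ 1 := by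
    constructor
    · rw [Units.val_mul, Units.val_mul]
      calc ‖((S⁻¹ : 𝔸ˣ) : 𝔸) * (P' : 𝔸) * ((P⁻¹ : 𝔸ˣ) : 𝔸)‖ ≤ ‖((S⁻¹ : 𝔸ˣ) : 𝔸) * (P' : 𝔸)‖ * ‖((P⁻¹ : 𝔸ˣ) : 𝔸)‖ := norm_mul_le _ _
        _ ≤ (‖((S⁻¹ : 𝔸ˣ) : 𝔸)‖ * ‖(P' : 𝔸)‖) * ‖((P⁻¹ : 𝔸ˣ) : 𝔸)‖ := mul_le_mul_of_nonneg_right (norm_mul_le _ _) (norm_nonneg _)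
        _ ≤ (1 * 1) * 1 := mul_le_mul (mul_le_mul hS.2 hP'.1 (norm_nonneg _) zero_le_one) hP.2 (norm_nonneg _) (by norm_num)
        _ = 1 := by norm_num
    · rw [mul_inv_rev, mul_inv_rev, inv_inv, inv_inv, Units.val_mul, Units.val_mul]
      calc ‖(P : 𝔸) * (((P'⁻¹ : 𝔸ˣ) : 𝔸) * (S : 𝔸))‖ ≤ ‖(P : 𝔸)‖ * ‖((P'⁻¹ : 𝔸ˣ) : 𝔸) * (S : 𝔸)‖ := norm_mul_le _ _
        _ ≤ ‖(P : 𝔸)‖ * (‖((P'⁻¹ : 𝔸ˣ) : 𝔸)‖ * ‖(S : 𝔸)‖) := mul_le_mul_of_nonneg_left (norm_mul_le _ _) (norm_nonneg _)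
        _ ≤ 1 * (1 * 1) := mul_le_mul hP.1 (mul_le_mul hP'.2 hS.1 (norm_nonneg _) zero_le_one) (by positivity) zero_le_one
        _ = 1 := by norm_num
  -- `R(P⁻¹)m − R(P′⁻¹)m′ = R(P′⁻¹)(R(P′P⁻¹)m − m′)`
  have e1 : R P⁻¹ m - R P'⁻¹ m' = R P'⁻¹ (R (P' * P⁻¹) m - m') := by
    rw [R_sub, ← B9Eq39Adjoint.R_mul, ← mul_assoc, inv_mul_cancel, one_mul]
  -- `R(P′P⁻¹)m − R(S)m = R(S)(R(S⁻¹P′P⁻¹)m − m)`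
  have e2 : R (P' * P⁻¹) m - R S m = R S (R (S⁻¹ * P' * P⁻¹) m - m) := by
    rw [R_sub, ← B9Eq39Adjoint.R_mul, ← mul_assoc, ← mul_assoc, mul_inv_cancel, one_mul]
  rw [e1, norm_R_eq hP'i.1 hP'i.2]
  calc ‖R (P' * P⁻¹) m - m'‖ = ‖(R (P' * P⁻¹) m - R S m) + (R S m - m')‖ := by rw [sub_add_sub_cancel]
    _ ≤ ‖R (P' * P⁻¹) m - R S m‖ + ‖R S m - m'‖ := norm_add_le _ _
    _ = ‖R (S⁻¹ * P' * P⁻¹) m - m‖ + ‖R S m - m'‖ := by rw [e2, norm_R_eq hS.1 hS.2]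
    _ = _ := by rw [norm_R_sub_self_eq_comm hU, add_comm]

/-- ★ **(J-δV-c) CHANGING THE TRANSPORT** (`W̄ ↔ S` defect): `‖R(S)m − m′‖ ≤ ‖R(T)m − m′‖ + ‖(T⁻¹S)·m − m·(T⁻¹S)‖` for bi-contractive `S, T`.
[cite: Balaban1985BackgroundPropagators, (3.1) p.390] -/
theorem norm_R_sub_le_of_defect {S T : 𝔸ˣ} (hS : ‖(S : 𝔸)‖ ≤ 1 ∧ ‖((S⁻¹ : 𝔸ˣ) : 𝔸)‖ ≤ 1) (hT : ‖(T : 𝔸)‖ ≤ 1 ∧ ‖((T⁻¹ : 𝔸ˣ) : 𝔸)‖ ≤ 1) (m m' : 𝔸) :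
    ‖R S m - m'‖ ≤ ‖R T m - m'‖ + ‖((T⁻¹ * S : 𝔸ˣ) : 𝔸) * m - m * ((T⁻¹ * S : 𝔸ˣ) : 𝔸)‖ := by
  have hU : ‖((T⁻¹ * S : 𝔸ˣ) : 𝔸)‖ ≤ 1 ∧ ‖(((T⁻¹ * S)⁻¹ : 𝔸ˣ) : 𝔸)‖ ≤ 1 := by
    constructor
    · rw [Units.val_mul]
      exact (norm_mul_le _ _).trans (by nlinarith [hT.2, hS.1, norm_nonneg (S : 𝔸), norm_nonneg ((T⁻¹ : 𝔸ˣ) : 𝔸)])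
    · rw [mul_inv_rev, inv_inv, Units.val_mul]
      exact (norm_mul_le _ _).trans (by nlinarith [hT.1, hS.2, norm_nonneg (T : 𝔸), norm_nonneg ((S⁻¹ : 𝔸ˣ) : 𝔸)])
  have e2 : R S m - R T m = R T (R (T⁻¹ * S) m - m) := by
    rw [R_sub, ← B9Eq39Adjoint.R_mul, ← mul_assoc, mul_inv_cancel, one_mul]
  calc ‖R S m - m'‖ = ‖(R S m - R T m) + (R T m - m')‖ := by rw [sub_add_sub_cancel]
    _ ≤ ‖R S m - R T m‖ + ‖R T m - m'‖ := norm_add_le _ _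
    _ = ‖R (T⁻¹ * S) m - m‖ + ‖R T m - m'‖ := by rw [e2, norm_R_eq hT.1 hT.2]
    _ = _ := by rw [norm_R_sub_self_eq_comm hU, add_comm]

/-- ★ **(J-δV-b) ONE TELESCOPING STEP** along a coarse path: `‖R(S₂S₁)m₀ − m₂‖ ≤ ‖R(S₁)m₀ − m₁‖ + ‖R(S₂)m₁ − m₂‖` for bi-contractive `S₂`.
[cite: Balaban1985BackgroundPropagators, (3.1) p.390, (3.12) p.392] -/
theorem norm_R_mul_sub_le {S₁ S₂ : 𝔸ˣ} (hS₂ : ‖(S₂ : 𝔸)‖ ≤ 1 ∧ ‖((S₂⁻¹ : 𝔸ˣ) : 𝔸)‖ ≤ 1) (m₀ m₁ m₂ : 𝔸) :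
    ‖R (S₂ * S₁) m₀ - m₂‖ ≤ ‖R S₁ m₀ - m₁‖ + ‖R S₂ m₁ - m₂‖ := by
  calc ‖R (S₂ * S₁) m₀ - m₂‖ = ‖R S₂ (R S₁ m₀ - m₁) + (R S₂ m₁ - m₂)‖ := by rw [B9Eq39Adjoint.R_mul, R_sub, sub_add_sub_cancel]
    _ ≤ ‖R S₂ (R S₁ m₀ - m₁)‖ + ‖R S₂ m₁ - m₂‖ := norm_add_le _ _
    _ = _ := by rw [norm_R_eq hS₂.1 hS₂.2]

end Algebra

/-! ## §2 The offset-comb model as a path transport, and the pointwise junction inequality -/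

section Torus

variable {𝔸 : Type*} [NormedRing 𝔸] [NormOneClass 𝔸] {P : Params} {j : ℕ} (V : GaugeField P j 𝔸ˣ)
  (hV : ∀ b : PBond P j, ‖(V b : 𝔸)‖ ≤ 1 ∧ ‖(((V b)⁻¹ : 𝔸ˣ) : 𝔸)‖ ≤ 1)

omit [NormOneClass 𝔸] in
/-- ★ the offset-comb local model is the inverse path transport of the centre datum: `R(axialT V c^h z)⁻¹ R(V(c₀;[ι]^h))⁻¹ m = R(V(c₀; [ι]^h ++ Γ_(0, rel c^h z)))⁻¹ m`, `c^h = c₀ + h·e_ι`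
(✓ `holT_append`, ✓ `disp_seg`). [cite: Balaban1985UV3, (27) p.263] -/
theorem axialModel_offset_eq_R_path (c₀ : Site P j) (ι : Fin P.d) (h : ℤ) (z : Site P j) (m : 𝔸) :
    R (axialT V (transl c₀ (h • e ι)) z)⁻¹ (R (holT V c₀ (seg ι h))⁻¹ m)
      = R (holT V c₀ (seg ι h ++ treeWord (rel (transl c₀ (h • e ι)) z)))⁻¹ m := by
  rw [← B9Eq39Adjoint.R_mul, ← mul_inv_rev, axialT, holT_append, disp_seg]

include hV in
/-- ★★ **THE POINTWISE JUNCTION INEQUALITY** (J-δV-a) for the offset-comb family: two bases `c₀, c₀′`, the same offset `h` and fine site `z`, data `m, m′`, ANY bi-contractive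
transport `S` (the consumer's straight coarse transport `c₀ → c₀′`):
`‖Ψ^h_(c₀)(z) − Ψ^h_(c₀′)(z)‖ ≤ ‖R(S)m − m′‖ + ‖[S⁻¹·V(c₀′; path′)·V(c₀; path)⁻¹, m]‖`, `path = [ι]^h ++ Γ_(0, rel c^h z)` — a coarse covariant difference plus the commutator of `m`
with the holonomy of the closed junction loop `c₀ → z → c₀′ → c₀`. [cite: Balaban1985BackgroundPropagators, (3.1) p.390, (3.12) p.392] [cite: Balaban1985UV3, (27) p.263] -/
theorem norm_axialModel_offset_sub_le (c₀ c₀' : Site P j) (ι : Fin P.d) (h : ℤ) (z : Site P j) (m m' : 𝔸) (S : 𝔸ˣ)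
    (hS : ‖(S : 𝔸)‖ ≤ 1 ∧ ‖((S⁻¹ : 𝔸ˣ) : 𝔸)‖ ≤ 1) :
    ‖R (axialT V (transl c₀ (h • e ι)) z)⁻¹ (R (holT V c₀ (seg ι h))⁻¹ m) - R (axialT V (transl c₀' (h • e ι)) z)⁻¹ (R (holT V c₀' (seg ι h))⁻¹ m')‖
      ≤ ‖R S m - m'‖
        + ‖((S⁻¹ * holT V c₀' (seg ι h ++ treeWord (rel (transl c₀' (h • e ι)) z)) * (holT V c₀ (seg ι h ++ treeWord (rel (transl c₀ (h • e ι)) z)))⁻¹ : 𝔸ˣ) : 𝔸) * m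
            - m * ((S⁻¹ * holT V c₀' (seg ι h ++ treeWord (rel (transl c₀' (h • e ι)) z)) * (holT V c₀ (seg ι h ++ treeWord (rel (transl c₀ (h • e ι)) z)))⁻¹ : 𝔸ˣ) : 𝔸)‖ := by
  rw [axialModel_offset_eq_R_path, axialModel_offset_eq_R_path]
  exact norm_R_inv_sub_R_inv_le (bicontr_holT V hV _ _) (bicontr_holT V hV _ _) hS m m'

end Torus

end Summit.QuantumFields.YangMills.Theorems.Prop7LocalModelJunction

end
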